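import Summits.AnomalousDissipation.AnomalousDissipation.Theorems.SolenoidalFractalHomogenisationRealisedQuasiStaticCellLawSlavedPair
import Mathlib.Analysis.Calculus.Deriv.Star
import HarnessLib

/-!
# K2R `RealisedQuasiStaticCellLaw`, line `floquet-bloch`, stub `stub_lowSectorDecay` (S1D): the slaved pair with a joint
# co-moving slow form — integrated form on a window (constant target rate)

Summits-side helper file (everything proved; no definitions, no named facts; `--supports stmt-AnomalousDissipation-20446`).
Integrates `slavedPair_pointwise` (file `…SlavedPair`): on a window `[t₀, t₁]` where the coupling `g` is differentiable
and the weights `a, b, c` of the joint slow form solve `a' = 2(λ₁ − λ̄)a`, `b' = 2(λ₂ − λ̄)b`, `c' = (λ₁ + λ₂ − 2λ̄)c`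
(`λ_k(t) = Λ(d₀ + g(t)²σ_k)`), the functional `Φ = a|v¹₀|² + b|v²₀|² + 2Re(c v̄¹₀ v²₀) + β(F¹ + F²)` satisfies
`Φ(t) ≤ exp(−2((1−ε)λ̄ − μ₀)(t − t₀)) Φ(t₀)` (`slavedPair_window`): a CONSTANT rate `λ̄` for the pair, whatever the
instantaneous anisotropy of the two slaved rates — the weights carry the difference (co-moving slow metric).
-/

set_option linter.dupNamespace false

namespace Summit.AnomalousDissipation.AnomalousDissipation.Theorems.SolenoidalFractalHomogenisation.RealisedQuasiStaticCellLaw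

noncomputable section

open Set Finset Complex
open scoped BigOperators ComplexConjugate

/-- **Slaved pair with a co-moving slow form: per-window contraction at a constant rate.** -/
theorem slavedPair_window (W : Finset ℤ) (h0 : (0 : ℤ) ∈ W) (h1 : (1 : ℤ) ∈ W) (hm1 : (-1 : ℤ) ∈ W)
    (d s₁ s₂ : ℤ → ℝ) (Λ gT gD Δ γ σ₁ σ₂ σ ε β lam Gmax Gmin t₀ t₁ : ℝ) (g g' wa wb : ℝ → ℝ) (wc : ℝ → ℂ)
    (v₁ v₂ : ℝ → ℤ → ℂ)
    (hs₁ : ∀ J ∈ W, |s₁ J| ≤ 1) (hs₂ : ∀ J ∈ W, |s₂ J| ≤ 1)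
    (hγ₁ : s₁ 0 ^ 2 + s₁ (-1) ^ 2 ≤ γ ^ 2) (hγ₂ : s₂ 0 ^ 2 + s₂ (-1) ^ 2 ≤ γ ^ 2) (hγ0 : 0 ≤ γ)
    (hσ₁ : σ₁ = s₁ (-1) ^ 2 / (d (-1) - d 0) + s₁ 0 ^ 2 / (d 1 - d 0))
    (hσ₂ : σ₂ = s₂ (-1) ^ 2 / (d (-1) - d 0) + s₂ 0 ^ 2 / (d 1 - d 0))
    (hσ₁le : σ₁ ≤ σ) (hσ₂le : σ₂ ≤ σ)
    (hΔ0 : 0 < Δ) (hΔ : ∀ J ∈ W, J ≠ 0 → d 0 + Δ ≤ d J) (hd0 : 0 ≤ d 0) (hΛ : 0 < Λ) (hε : 0 ≤ ε) (hβ : 0 ≤ β)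
    (hlam : 0 ≤ lam) (hGmin : 0 < Gmin)
    (hGmax : ∀ t ∈ Icc t₀ t₁, wa t ≤ Gmax ∧ wb t ≤ Gmax ∧ ‖wc t‖ ≤ Gmax)
    (hG : ∀ t ∈ Icc t₀ t₁, ∀ y₁ y₂ : ℂ,
      Gmin * (‖y₁‖ ^ 2 + ‖y₂‖ ^ 2) ≤ wa t * ‖y₁‖ ^ 2 + wb t * ‖y₂‖ ^ 2 + 2 * (wc t * conj y₁ * y₂).re)
    (hβ' : 16 * Gmax ^ 2 * gT ^ 2 * Λ * γ ^ 2 ≤ Gmin * ε * lam * β * Δ)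
    (hgT : ∀ t ∈ Icc t₀ t₁, |g t| ≤ gT) (hgD : ∀ t ∈ Icc t₀ t₁, |g' t| ≤ gD)
    (hg : ∀ t ∈ Icc t₀ t₁, HasDerivWithinAt g (g' t) (Icc t₀ t₁) t)
    (hsmall : gT ^ 2 * (4 * γ ^ 2 / Δ) + 2 * lam / Λ ≤ Δ)
    (hwa : ∀ t ∈ Icc t₀ t₁, HasDerivWithinAt wa ((2 * (Λ * (d 0 + g t ^ 2 * σ₁) - lam)) * wa t) (Icc t₀ t₁) t)
    (hwb : ∀ t ∈ Icc t₀ t₁, HasDerivWithinAt wb ((2 * (Λ * (d 0 + g t ^ 2 * σ₂) - lam)) * wb t) (Icc t₀ t₁) t)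
    (hwc : ∀ t ∈ Icc t₀ t₁, HasDerivWithinAt wc
      ((((Λ * (d 0 + g t ^ 2 * σ₁) + Λ * (d 0 + g t ^ 2 * σ₂) - 2 * lam : ℝ) : ℂ) * wc t)) (Icc t₀ t₁) t)
    (hsupp₁ : ∀ t ∈ Icc t₀ t₁, ∀ J, J ∉ W → v₁ t J = 0) (hsupp₂ : ∀ t ∈ Icc t₀ t₁, ∀ J, J ∉ W → v₂ t J = 0)
    (hderiv₁ : ∀ t ∈ Icc t₀ t₁, ∀ J ∈ W, HasDerivWithinAt (fun τ => v₁ τ J)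
        (-(Λ : ℂ) * ((d J : ℂ) * v₁ t J) -
          (g t : ℂ) * (Λ : ℂ) * ((s₁ (J - 1) : ℂ) * v₁ t (J - 1) - (s₁ J : ℂ) * v₁ t (J + 1))) (Icc t₀ t₁) t)
    (hderiv₂ : ∀ t ∈ Icc t₀ t₁, ∀ J ∈ W, HasDerivWithinAt (fun τ => v₂ τ J)
        (-(Λ : ℂ) * ((d J : ℂ) * v₂ t J) -
          (g t : ℂ) * (Λ : ℂ) * ((s₂ (J - 1) : ℂ) * v₂ t (J - 1) - (s₂ J : ℂ) * v₂ t (J + 1))) (Icc t₀ t₁) t) :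
    ∀ t ∈ Icc t₀ t₁,
      wa t * ‖v₁ t 0‖ ^ 2 + wb t * ‖v₂ t 0‖ ^ 2 + 2 * (wc t * conj (v₁ t 0) * v₂ t 0).re +
          β * (∑ J ∈ W.erase 0, ‖v₁ t J - ((if J = 1 then -(g t * s₁ 0 / (d 1 - d 0))
              else if J = -1 then g t * s₁ (-1) / (d (-1) - d 0) else 0 : ℝ) : ℂ) * v₁ t 0‖ ^ 2 +
            ∑ J ∈ W.erase 0, ‖v₂ t J - ((if J = 1 then -(g t * s₂ 0 / (d 1 - d 0))
              else if J = -1 then g t * s₂ (-1) / (d (-1) - d 0) else 0 : ℝ) : ℂ) * v₂ t 0‖ ^ 2) ≤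
        Real.exp (-(2 * ((1 - ε) * lam - 4 * β * γ ^ 2 * (Λ * gT ^ 3 * σ + gD + Λ * gT ^ 2) ^ 2 / (Gmin * Λ * Δ ^ 3)) *
            (t - t₀))) *
          (wa t₀ * ‖v₁ t₀ 0‖ ^ 2 + wb t₀ * ‖v₂ t₀ 0‖ ^ 2 + 2 * (wc t₀ * conj (v₁ t₀ 0) * v₂ t₀ 0).re +
            β * (∑ J ∈ W.erase 0, ‖v₁ t₀ J - ((if J = 1 then -(g t₀ * s₁ 0 / (d 1 - d 0))
                else if J = -1 then g t₀ * s₁ (-1) / (d (-1) - d 0) else 0 : ℝ) : ℂ) * v₁ t₀ 0‖ ^ 2 +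
              ∑ J ∈ W.erase 0, ‖v₂ t₀ J - ((if J = 1 then -(g t₀ * s₂ 0 / (d 1 - d 0))
                else if J = -1 then g t₀ * s₂ (-1) / (d (-1) - d 0) else 0 : ℝ) : ℂ) * v₂ t₀ 0‖ ^ 2)) := by
  classical
  -- profiles, profile derivatives, fields, fast energies (per ladder, as functions of time)
  obtain ⟨hf₁, hhf₁⟩ : ∃ hf : ℝ → ℤ → ℝ, hf = fun τ J => if J = 1 then -(g τ * s₁ 0 / (d 1 - d 0))
      else if J = -1 then g τ * s₁ (-1) / (d (-1) - d 0) else 0 := ⟨_, rfl⟩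
  obtain ⟨hf₂, hhf₂⟩ : ∃ hf : ℝ → ℤ → ℝ, hf = fun τ J => if J = 1 then -(g τ * s₂ 0 / (d 1 - d 0))
      else if J = -1 then g τ * s₂ (-1) / (d (-1) - d 0) else 0 := ⟨_, rfl⟩
  obtain ⟨hd₁, hhd₁⟩ : ∃ hd : ℝ → ℤ → ℝ, hd = fun τ J => if J = 1 then -(g' τ * s₁ 0 / (d 1 - d 0))
      else if J = -1 then g' τ * s₁ (-1) / (d (-1) - d 0) else 0 := ⟨_, rfl⟩
  obtain ⟨hd₂, hhd₂⟩ : ∃ hd : ℝ → ℤ → ℝ, hd = fun τ J => if J = 1 then -(g' τ * s₂ 0 / (d 1 - d 0))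
      else if J = -1 then g' τ * s₂ (-1) / (d (-1) - d 0) else 0 := ⟨_, rfl⟩
  obtain ⟨Fv₁, hFv₁⟩ : ∃ Fv : ℝ → ℤ → ℂ, Fv = fun τ J => -(Λ : ℂ) * ((d J : ℂ) * v₁ τ J) -
      (g τ : ℂ) * (Λ : ℂ) * ((s₁ (J - 1) : ℂ) * v₁ τ (J - 1) - (s₁ J : ℂ) * v₁ τ (J + 1)) := ⟨_, rfl⟩
  obtain ⟨Fv₂, hFv₂⟩ : ∃ Fv : ℝ → ℤ → ℂ, Fv = fun τ J => -(Λ : ℂ) * ((d J : ℂ) * v₂ τ J) -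
      (g τ : ℂ) * (Λ : ℂ) * ((s₂ (J - 1) : ℂ) * v₂ τ (J - 1) - (s₂ J : ℂ) * v₂ τ (J + 1)) := ⟨_, rfl⟩
  obtain ⟨Φ, hΦ⟩ : ∃ Φ : ℝ → ℝ, Φ = fun τ =>
      wa τ * ‖v₁ τ 0‖ ^ 2 + wb τ * ‖v₂ τ 0‖ ^ 2 + 2 * (wc τ * conj (v₁ τ 0) * v₂ τ 0).re +
        β * (∑ J ∈ W.erase 0, ‖v₁ τ J - ((hf₁ τ J : ℝ) : ℂ) * v₁ τ 0‖ ^ 2 +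
          ∑ J ∈ W.erase 0, ‖v₂ τ J - ((hf₂ τ J : ℝ) : ℂ) * v₂ τ 0‖ ^ 2) := ⟨_, rfl⟩
  obtain ⟨μ₀, hμ₀⟩ : ∃ μ₀ : ℝ, μ₀ = 4 * β * γ ^ 2 * (Λ * gT ^ 3 * σ + gD + Λ * gT ^ 2) ^ 2 / (Gmin * Λ * Δ ^ 3) :=
    ⟨_, rfl⟩
  obtain ⟨D, hD⟩ : ∃ D : ℝ → ℝ, D = fun τ =>
      ((2 * (Λ * (d 0 + g τ ^ 2 * σ₁) - lam) * wa τ) * ‖v₁ τ 0‖ ^ 2 +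
          (2 * (Λ * (d 0 + g τ ^ 2 * σ₂) - lam) * wb τ) * ‖v₂ τ 0‖ ^ 2 +
          2 * ((((Λ * (d 0 + g τ ^ 2 * σ₁) + Λ * (d 0 + g τ ^ 2 * σ₂) - 2 * lam : ℝ) : ℂ) * wc τ) *
            conj (v₁ τ 0) * v₂ τ 0).re +
        (wa τ * (2 * (Fv₁ τ 0 * conj (v₁ τ 0)).re) + wb τ * (2 * (Fv₂ τ 0 * conj (v₂ τ 0)).re) +
          2 * (wc τ * conj (Fv₁ τ 0) * v₂ τ 0 + wc τ * conj (v₁ τ 0) * Fv₂ τ 0).re)) +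
      β * (∑ J ∈ W.erase 0,
          2 * ((Fv₁ τ J - (((hd₁ τ J : ℝ) : ℂ) * v₁ τ 0 + ((hf₁ τ J : ℝ) : ℂ) * Fv₁ τ 0)) *
            conj (v₁ τ J - ((hf₁ τ J : ℝ) : ℂ) * v₁ τ 0)).re +
        ∑ J ∈ W.erase 0,
          2 * ((Fv₂ τ J - (((hd₂ τ J : ℝ) : ℂ) * v₂ τ 0 + ((hf₂ τ J : ℝ) : ℂ) * Fv₂ τ 0)) *
            conj (v₂ τ J - ((hf₂ τ J : ℝ) : ℂ) * v₂ τ 0)).re) := ⟨_, rfl⟩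
  -- per-ladder calculus (as in `slavedLadder_window`)
  have hlad : ∀ (sL : ℤ → ℝ) (vL : ℝ → ℤ → ℂ) (hfL hdL : ℝ → ℤ → ℝ) (FvL : ℝ → ℤ → ℂ),
      (hfL = fun τ J => if J = 1 then -(g τ * sL 0 / (d 1 - d 0))
        else if J = -1 then g τ * sL (-1) / (d (-1) - d 0) else 0) →
      (hdL = fun τ J => if J = 1 then -(g' τ * sL 0 / (d 1 - d 0))
        else if J = -1 then g' τ * sL (-1) / (d (-1) - d 0) else 0) →
      (FvL = fun τ J => -(Λ : ℂ) * ((d J : ℂ) * vL τ J) -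
        (g τ : ℂ) * (Λ : ℂ) * ((sL (J - 1) : ℂ) * vL τ (J - 1) - (sL J : ℂ) * vL τ (J + 1))) →
      (∀ t ∈ Icc t₀ t₁, ∀ J ∈ W, HasDerivWithinAt (fun τ => vL τ J)
        (-(Λ : ℂ) * ((d J : ℂ) * vL t J) -
          (g t : ℂ) * (Λ : ℂ) * ((sL (J - 1) : ℂ) * vL t (J - 1) - (sL J : ℂ) * vL t (J + 1))) (Icc t₀ t₁) t) →
      ∀ τ ∈ Icc t₀ t₁,
        (∀ J ∈ W, HasDerivWithinAt (fun τ' => vL τ' J) (FvL τ J) (Icc t₀ t₁) τ) ∧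
        HasDerivWithinAt (fun τ' => ∑ J ∈ W.erase 0, ‖vL τ' J - ((hfL τ' J : ℝ) : ℂ) * vL τ' 0‖ ^ 2)
          (∑ J ∈ W.erase 0, 2 * ((FvL τ J - (((hdL τ J : ℝ) : ℂ) * vL τ 0 + ((hfL τ J : ℝ) : ℂ) * FvL τ 0)) *
            conj (vL τ J - ((hfL τ J : ℝ) : ℂ) * vL τ 0)).re) (Icc t₀ t₁) τ := by
    intro sL vL hfL hdL FvL hhfL hhdL hFvL hderivL τ hτ
    have hvJ : ∀ J ∈ W, HasDerivWithinAt (fun τ' => vL τ' J) (FvL τ J) (Icc t₀ t₁) τ := fun J hJ => by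
      rw [hFvL]; exact hderivL τ hτ J hJ
    have hhfJ : ∀ J, HasDerivWithinAt (fun τ' => ((hfL τ' J : ℝ) : ℂ)) ((hdL τ J : ℝ) : ℂ) (Icc t₀ t₁) τ := by
      intro J
      by_cases hJ1 : J = 1
      · subst hJ1
        have e1 : (fun τ' => ((hfL τ' 1 : ℝ) : ℂ)) = fun τ' => (((-(g τ' * sL 0 / (d 1 - d 0))) : ℝ) : ℂ) := by
          funext τ'; rw [hhfL]; simp
        have e2 : hdL τ 1 = -(g' τ * sL 0 / (d 1 - d 0)) := by rw [hhdL]; simp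
        rw [e1, e2]
        exact (((hg τ hτ).mul_const (sL 0)).div_const (d 1 - d 0)).neg.ofReal_comp
      · by_cases hJm1 : J = -1
        · subst hJm1
          have e1 : (fun τ' => ((hfL τ' (-1) : ℝ) : ℂ)) = fun τ' => (((g τ' * sL (-1) / (d (-1) - d 0)) : ℝ) : ℂ) := by
            funext τ'; rw [hhfL]; norm_num
          have e2 : hdL τ (-1) = g' τ * sL (-1) / (d (-1) - d 0) := by rw [hhdL]; norm_num
          rw [e1, e2]
          exact (((hg τ hτ).mul_const (sL (-1))).div_const (d (-1) - d 0)).ofReal_comp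
        · have e1 : (fun τ' => ((hfL τ' J : ℝ) : ℂ)) = fun _ => (0 : ℂ) := by
            funext τ'; rw [hhfL]; simp [hJ1, hJm1]
          have e2 : hdL τ J = 0 := by rw [hhdL]; simp [hJ1, hJm1]
          rw [e1, e2, Complex.ofReal_zero]
          exact hasDerivWithinAt_const τ (Icc t₀ t₁) (0 : ℂ)
    refine ⟨hvJ, ?_⟩
    have hrJ : ∀ J ∈ W.erase 0, HasDerivWithinAt (fun τ' => ‖vL τ' J - ((hfL τ' J : ℝ) : ℂ) * vL τ' 0‖ ^ 2)
        (2 * ((FvL τ J - (((hdL τ J : ℝ) : ℂ) * vL τ 0 + ((hfL τ J : ℝ) : ℂ) * FvL τ 0)) *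
          conj (vL τ J - ((hfL τ J : ℝ) : ℂ) * vL τ 0)).re) (Icc t₀ t₁) τ := by
      intro J hJ
      have h := ((hvJ J (Finset.mem_of_mem_erase hJ)).sub ((hhfJ J).mul (hvJ 0 h0))).norm_sq
      simp only [Complex.inner] at h
      exact h
    exact HasDerivWithinAt.fun_sum hrJ
  -- Step 1: `Φ' = D`
  have hΦderiv : ∀ τ ∈ Icc t₀ t₁, HasDerivWithinAt Φ (D τ) (Icc t₀ t₁) τ := by
    intro τ hτ
    obtain ⟨hv₁J, hF₁⟩ := hlad s₁ v₁ hf₁ hd₁ Fv₁ hhf₁ hhd₁ hFv₁ hderiv₁ τ hτ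
    obtain ⟨hv₂J, hF₂⟩ := hlad s₂ v₂ hf₂ hd₂ Fv₂ hhf₂ hhd₂ hFv₂ hderiv₂ τ hτ
    have h10 : HasDerivWithinAt (fun τ' => ‖v₁ τ' 0‖ ^ 2) (2 * (Fv₁ τ 0 * conj (v₁ τ 0)).re) (Icc t₀ t₁) τ := by
      have h := (hv₁J 0 h0).norm_sq; simp only [Complex.inner] at h; exact h
    have h20 : HasDerivWithinAt (fun τ' => ‖v₂ τ' 0‖ ^ 2) (2 * (Fv₂ τ 0 * conj (v₂ τ 0)).re) (Icc t₀ t₁) τ := by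
      have h := (hv₂J 0 h0).norm_sq; simp only [Complex.inner] at h; exact h
    have hA := (hwa τ hτ).mul h10
    have hB := (hwb τ hτ).mul h20
    -- the mixed term `2 Re(wc conj(v₁0) v₂0)`
    have hconj : HasDerivWithinAt (fun τ' => conj (v₁ τ' 0)) (conj (Fv₁ τ 0)) (Icc t₀ t₁) τ := by
      have h := (hv₁J 0 h0).star
      simpa using h
    have hmix : HasDerivWithinAt (fun τ' => wc τ' * conj (v₁ τ' 0) * v₂ τ' 0)
        ((((Λ * (d 0 + g τ ^ 2 * σ₁) + Λ * (d 0 + g τ ^ 2 * σ₂) - 2 * lam : ℝ) : ℂ) * wc τ) * conj (v₁ τ 0) * v₂ τ 0 +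
          wc τ * conj (Fv₁ τ 0) * v₂ τ 0 + wc τ * conj (v₁ τ 0) * Fv₂ τ 0) (Icc t₀ t₁) τ := by
      have h := ((hwc τ hτ).mul hconj).mul (hv₂J 0 h0)
      refine h.congr_deriv ?_
      simp only [Pi.mul_apply]
      ring
    have hmixre : HasDerivWithinAt (fun τ' => (wc τ' * conj (v₁ τ' 0) * v₂ τ' 0).re)
        ((((Λ * (d 0 + g τ ^ 2 * σ₁) + Λ * (d 0 + g τ ^ 2 * σ₂) - 2 * lam : ℝ) : ℂ) * wc τ) * conj (v₁ τ 0) * v₂ τ 0 +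
          wc τ * conj (Fv₁ τ 0) * v₂ τ 0 + wc τ * conj (v₁ τ 0) * Fv₂ τ 0).re (Icc t₀ t₁) τ := by
      have h := Complex.reCLM.hasFDerivAt.comp_hasDerivWithinAt τ hmix
      simp only [Function.comp_def, Complex.reCLM_apply] at h
      exact h
    have hS := (hA.add hB).add (hmixre.const_mul 2)
    have hF := (hF₁.add hF₂).const_mul β
    have htot := hS.add hF
    rw [hΦ, hD]
    refine htot.congr_deriv ?_
    simp only [Complex.add_re]
    ring
  -- Step 2: pointwise inequality
  have hpoint : ∀ τ ∈ Icc t₀ t₁, D τ + (2 * ((1 - ε) * lam) - 2 * μ₀) * Φ τ ≤ 0 := by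
    intro τ hτ
    have h := slavedPair_pointwise W h1 hm1 d s₁ s₂ Λ gT gD Δ γ σ₁ σ₂ σ ε β (g τ) (g' τ) lam Gmax Gmin (wa τ) (wb τ)
      (wc τ) (v₁ τ) (v₂ τ) (Fv₁ τ) (Fv₂ τ) (hf₁ τ) (hd₁ τ) (hf₂ τ) (hd₂ τ) hs₁ hs₂ hγ₁ hγ₂ hγ0 hσ₁ hσ₂ hσ₁le hσ₂le
      hΔ0 hΔ hd0 hΛ hε hβ hlam hGmin (hGmax τ hτ) (hG τ hτ) hβ' (hgT τ hτ) (hgD τ hτ) hsmall (hsupp₁ τ hτ) (hsupp₂ τ hτ)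
      (fun J => by rw [hFv₁]) (fun J => by rw [hFv₂]) (fun J => by rw [hhf₁]) (fun J => by rw [hhd₁])
      (fun J => by rw [hhf₂]) (fun J => by rw [hhd₂])
    rw [hD, hΦ, hμ₀]
    exact h
  -- Step 3: Grönwall at constant rate
  obtain ⟨r, hr⟩ : ∃ r : ℝ, r = 2 * ((1 - ε) * lam) - 2 * μ₀ := ⟨_, rfl⟩
  have hΨderiv : ∀ τ ∈ Icc t₀ t₁, HasDerivWithinAt (fun τ' => Real.exp (r * (τ' - t₀)) * Φ τ')
      (Real.exp (r * (τ - t₀)) * r * Φ τ + Real.exp (r * (τ - t₀)) * D τ) (Icc t₀ t₁) τ := by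
    intro τ hτ
    have he : HasDerivWithinAt (fun τ' => Real.exp (r * (τ' - t₀))) (Real.exp (r * (τ - t₀)) * r) (Icc t₀ t₁) τ := by
      have h1' := ((hasDerivWithinAt_id τ (Icc t₀ t₁)).sub_const t₀).const_mul r
      have h2 := h1'.exp
      refine h2.congr_deriv ?_
      simp
    exact he.mul (hΦderiv τ hτ)
  have hΨanti : AntitoneOn (fun τ' => Real.exp (r * (τ' - t₀)) * Φ τ') (Icc t₀ t₁) := by
    refine antitoneOn_of_hasDerivWithinAt_nonpos (convex_Icc t₀ t₁)
      (f' := fun τ => Real.exp (r * (τ - t₀)) * r * Φ τ + Real.exp (r * (τ - t₀)) * D τ)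
      (fun τ hτ => (hΨderiv τ hτ).continuousWithinAt) (fun τ hτ => ?_) (fun τ hτ => ?_)
    · rw [interior_Icc] at hτ
      exact ((hΨderiv τ (Ioo_subset_Icc_self hτ)).mono (interior_subset)).mono_of_mem_nhdsWithin
        (by rw [interior_Icc]; exact self_mem_nhdsWithin)
    · rw [interior_Icc] at hτ
      have hτ' := Ioo_subset_Icc_self hτ
      have e : Real.exp (r * (τ - t₀)) * r * Φ τ + Real.exp (r * (τ - t₀)) * D τ =
          Real.exp (r * (τ - t₀)) * (D τ + (2 * ((1 - ε) * lam) - 2 * μ₀) * Φ τ) := by rw [hr]; ring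
      rw [e]
      exact mul_nonpos_of_nonneg_of_nonpos (Real.exp_pos _).le (hpoint τ hτ')
  intro t ht
  have ht₀ : t₀ ∈ Icc t₀ t₁ := ⟨le_rfl, ht.1.trans ht.2⟩
  have hmono := hΨanti ht₀ ht ht.1
  simp only [sub_self, mul_zero, Real.exp_zero, one_mul] at hmono
  have hΦt : Φ t ≤ Real.exp (-(r * (t - t₀))) * Φ t₀ := by
    have hpos := Real.exp_pos (-(r * (t - t₀)))
    have := mul_le_mul_of_nonneg_left hmono hpos.le
    rwa [← mul_assoc, ← Real.exp_add, neg_add_cancel, Real.exp_zero, one_mul] at this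
  have eΦ : ∀ τ, Φ τ = wa τ * ‖v₁ τ 0‖ ^ 2 + wb τ * ‖v₂ τ 0‖ ^ 2 + 2 * (wc τ * conj (v₁ τ 0) * v₂ τ 0).re +
      β * (∑ J ∈ W.erase 0, ‖v₁ τ J - ((if J = 1 then -(g τ * s₁ 0 / (d 1 - d 0))
          else if J = -1 then g τ * s₁ (-1) / (d (-1) - d 0) else 0 : ℝ) : ℂ) * v₁ τ 0‖ ^ 2 +
        ∑ J ∈ W.erase 0, ‖v₂ τ J - ((if J = 1 then -(g τ * s₂ 0 / (d 1 - d 0))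
          else if J = -1 then g τ * s₂ (-1) / (d (-1) - d 0) else 0 : ℝ) : ℂ) * v₂ τ 0‖ ^ 2) := by
    intro τ; rw [hΦ, hhf₁, hhf₂]
  have er : -(r * (t - t₀)) = -(2 * ((1 - ε) * lam - 4 * β * γ ^ 2 * (Λ * gT ^ 3 * σ + gD + Λ * gT ^ 2) ^ 2 /
      (Gmin * Λ * Δ ^ 3)) * (t - t₀)) := by rw [hr, hμ₀]; ring
  rw [← eΦ t, ← eΦ t₀, ← er]
  exact hΦt

end

end Summit.AnomalousDissipation.AnomalousDissipation.Theorems.SolenoidalFractalHomogenisation.RealisedQuasiStaticCellLaw
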